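import Literature.AnabelianGeometry.EtaleTheta.FreeProfinitePermBasis
import HarnessLib

/-!
# Shadows in a profinite completion — a small toolkit (generic; used by the ROUTE-PBF P-chain)

For a group `D`, its profinite completion `D̂ = profiniteCompletion D` is the limit of `D/M` over finite-index normal
`M ⊴ D`; `shadow M x := x.val M ∈ D/M` is the `M`-coordinate.  THEOREMS [cite: RibesZalesskii2010, §3.2]:
closed/open fibres of `shadow M` (stated WITHOUT any topology instance on the quotients), separation
(`eq_of_forall_shadow_eq`), the ENDGAME lemma `mem_of_forall_exists_shadow_eq` («a closed `C` meeting every `M`-shadow of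
`γ` contains `γ`», i.e. `⋂_M C·K_M = C`, by compactness), completed homomorphisms `mapHat φ` with `mapHat_toCompletion`,
`mapHat_comp_apply`, `shadow_mapHat` (the `M'`-shadow of `φ̂ x` is the image of the `φ⁻¹M'`-shadow of `x`),
`shadow_eq_of_mapHat_eq`, triviality/identity/isomorphism maps, `η` injective/surjective for FINITE groups, injectivity and
range of `mapHat ι` for an injective `ι` with finite-index range (from the LANDED comparison
`profiniteCompletionMap_subtype_injective_and_range`), and EXACTNESS `mem_closure_ker_of_mapHat_eq_one` of
`ker φ → E → P` after completion for finite `P`.  Namespace of the P-chain (`…SettingModel.TreeFree`) for by-name use there.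

HONEST FRAMING. Classical profinite group theory (free profinite groups as completions of free groups, free profinite
products of finite groups as completions of free products); theorems only, no named-fact hypothesis; the four candidate `Prop`s of
`FreeProfinitePermBasis.lean` are all PROVED in this packet (`_holds`); no (E)-class module and no `SettingModel*` file is
imported; nothing of [EtTh]/[IUTchII]/[IUTchIII] in print is asserted; CELL hextΔ/hΘ UNDECIDED-AT-MODEL; no side is taken on
[IUTchIII] Cor. 3.12; nothing here says abc is proved or refuted.  abc-iut cell, programme P-L2, rung (L3′), ROUTE-PBF,
P-chain (seat abc-iut-w6-d081 GEN 23; v3 GEN 24); desk: PL3-TREEFREE (abc-iut-L6-t19 g22) + PL3-PBF-READ (this seat).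
-/

noncomputable section

open scoped Classical

namespace Literature.AnabelianGeometry.EtaleTheta.SettingModel.TreeFree

open CategoryTheory Topology
open Literature.IUT.HodgeTheaters (profiniteCompletion toCompletion)

universe u


section Shadow

variable {D : Type u} [Group D]


/-- The `M`-shadow of `η d` is the class of `d`. [cite: RibesZalesskii2010, §3.2] -/
theorem shadow_toCompletion (M : FiniteIndexNormalSubgroup D) (d : D) :
    shadow M (toCompletion D d) = QuotientGroup.mk d := rfl

/-- Shadows are multiplicative. [cite: RibesZalesskii2010, §3.2] -/
theorem shadow_mul (M : FiniteIndexNormalSubgroup D) (x y : profiniteCompletion D) :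
    shadow M (x * y) = shadow M x * shadow M y := rfl

/-- Every class mod `M` is the shadow of some element of the completion (indeed of some `η d`). [cite: RibesZalesskii2010, §3.2] -/
theorem shadow_surjective (M : FiniteIndexNormalSubgroup D) : Function.Surjective (shadow (D := D) M) := by
  intro a
  obtain ⟨d, rfl⟩ := QuotientGroup.mk_surjective a
  exact ⟨toCompletion D d, rfl⟩

/-- Two elements of `D̂` with the same shadow at every finite-index normal `M` are equal. [cite: RibesZalesskii2010, §3.2] -/
theorem eq_of_forall_shadow_eq {x y : profiniteCompletion D} (h : ∀ M, shadow M x = shadow M y) : x = y :=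
  Subtype.ext (funext h)

/-- Compatibility of shadows along `M ≤ N`, on representatives. [cite: RibesZalesskii2010, §3.2] -/
theorem shadow_le {M N : FiniteIndexNormalSubgroup D} (h : M ≤ N) (x : profiniteCompletion D) (d : D)
    (hd : shadow M x = QuotientGroup.mk d) : shadow N x = QuotientGroup.mk d := by
  unfold shadow at hd ⊢
  rw [← x.prop h.hom, hd]
  rfl

/-- the `M`-th projection of the limit cone, as a continuous map into the (discrete, finite) diagram object [cite: RibesZalesskii2010, §3.2] -/
theorem continuous_val (M : FiniteIndexNormalSubgroup D) :
    Continuous (fun x : profiniteCompletion D =>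
      (x.val M : (ProfiniteGrp.ProfiniteCompletion.diagram (GrpCat.of D)).obj M)) :=
  ((ProfiniteGrp.limitCone (ProfiniteGrp.ProfiniteCompletion.diagram (GrpCat.of D))).π.app M).hom.continuous_toFun

/-- fibres of `shadow M` are closed [cite: RibesZalesskii2010, §3.2] -/
theorem isClosed_shadow_fibre (M : FiniteIndexNormalSubgroup D) (a : D ⧸ M.toSubgroup) :
    IsClosed {x : profiniteCompletion D | shadow M x = a} := by
  have h : IsClosed ({(a : (ProfiniteGrp.ProfiniteCompletion.diagram (GrpCat.of D)).obj M)} :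
      Set ((ProfiniteGrp.ProfiniteCompletion.diagram (GrpCat.of D)).obj M)) := isClosed_singleton
  exact h.preimage (continuous_val M)

/-- fibres of `shadow M` are open (the quotient is finite: complement of the finitely many other closed fibres) [cite: RibesZalesskii2010, §3.2] -/
theorem isOpen_shadow_fibre (M : FiniteIndexNormalSubgroup D) (a : D ⧸ M.toSubgroup) :
    IsOpen {x : profiniteCompletion D | shadow M x = a} := by
  haveI : Finite (D ⧸ M.toSubgroup) := Subgroup.finite_quotient_of_finiteIndex
  have hset : {x : profiniteCompletion D | shadow M x = a} =
      (⋃ a' ∈ ({a}ᶜ : Set (D ⧸ M.toSubgroup)), {x : profiniteCompletion D | shadow M x = a'})ᶜ := by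
    ext x
    simp only [Set.mem_setOf_eq, Set.mem_compl_iff, Set.mem_iUnion, Set.mem_singleton_iff, exists_prop,
      not_exists, not_and]
    constructor
    · rintro h a' ha' h'; exact ha' (h'.symm.trans h)
    · intro h; by_contra hne; exact h (shadow M x) hne rfl
  rw [hset]
  exact (Set.Finite.isClosed_biUnion (Set.toFinite _) fun a' _ => isClosed_shadow_fibre M a').isOpen_compl

/-- a function into a finite quotient with closed fibres, composed: closedness of a "coincidence set" with a shadow [cite: RibesZalesskii2010, §3.2] -/
theorem isClosed_setOf_shadow_eq_of_fibres {X : Type*} [TopologicalSpace X] {f : X → profiniteCompletion D}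
    (hf : Continuous f) (M : FiniteIndexNormalSubgroup D) (g : X → D ⧸ M.toSubgroup)
    (hg : ∀ a, IsClosed {x | g x = a}) : IsClosed {x | shadow M (f x) = g x} := by
  haveI : Finite (D ⧸ M.toSubgroup) := Subgroup.finite_quotient_of_finiteIndex
  have hset : {x | shadow M (f x) = g x} = ⋃ a : D ⧸ M.toSubgroup, ({x | shadow M (f x) = a} ∩ {x | g x = a}) := by
    ext x
    simp only [Set.mem_setOf_eq, Set.mem_iUnion, Set.mem_inter_iff]
    exact ⟨fun h => ⟨g x, h, rfl⟩, fun ⟨a, h1, h2⟩ => h1.trans h2.symm⟩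
  rw [hset]
  exact isClosed_iUnion_of_finite fun a => ((isClosed_shadow_fibre M a).preimage hf).inter (hg a)

/-- **ENDGAME** (`⋂_M C·K_M = C`): for a closed set `C ⊆ D̂`, if for every finite-index normal `M ⊴ D` some
element of `C` has the same `M`-shadow as `γ`, then `γ ∈ C`. [cite: RibesZalesskii2010, §3.2] -/
theorem mem_of_forall_exists_shadow_eq {C : Set (profiniteCompletion D)} (hC : IsClosed C)
    {γ : profiniteCompletion D} (h : ∀ M : FiniteIndexNormalSubgroup D, ∃ c ∈ C, shadow M c = shadow M γ) :
    γ ∈ C := by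
  by_contra hγ
  haveI : Nonempty (FiniteIndexNormalSubgroup D) := ⟨FiniteIndexNormalSubgroup.ofSubgroup (⊤ : Subgroup D)⟩
  have hsep : ∀ c ∈ C, ∃ M : FiniteIndexNormalSubgroup D, shadow M c ≠ shadow M γ := by
    intro c hc
    by_contra hall
    have hall' : ∀ M : FiniteIndexNormalSubgroup D, shadow M c = shadow M γ := fun M => by
      by_contra hne; exact hall ⟨M, hne⟩
    exact hγ ((eq_of_forall_shadow_eq hall') ▸ hc)
  choose! Mof hMof using hsep
  let U : profiniteCompletion D → Set (profiniteCompletion D) :=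
    fun c => {y | shadow (Mof c) y = shadow (Mof c) γ}ᶜ
  have hUo : ∀ c ∈ C, IsOpen (U c) := fun c _ => (isClosed_shadow_fibre (Mof c) (shadow (Mof c) γ)).isOpen_compl
  have hcov : C ⊆ ⋃ c ∈ C, U c := fun c hc => Set.mem_iUnion₂.mpr ⟨c, hc, hMof c hc⟩
  obtain ⟨t, htC, htfin, hsub⟩ := hC.isCompact.elim_finite_subcover_image hUo hcov
  -- `t` is non-empty (else `C = ∅`, contradicting `h`)
  obtain ⟨c₀, hc₀C, -⟩ := h (FiniteIndexNormalSubgroup.ofSubgroup (⊤ : Subgroup D))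
  have htne : htfin.toFinset.Nonempty := by
    rw [Set.Finite.toFinset_nonempty]
    by_contra hte
    rw [Set.not_nonempty_iff_eq_empty] at hte
    have := hsub hc₀C
    rw [hte] at this
    simp at this
  let M : FiniteIndexNormalSubgroup D := htfin.toFinset.inf' htne Mof
  obtain ⟨c, hcC, hc⟩ := h M
  obtain ⟨ci, hci, hcU⟩ := Set.mem_iUnion₂.mp (hsub hcC)
  have hle : M ≤ Mof ci := Finset.inf'_le Mof (htfin.mem_toFinset.mpr hci)
  obtain ⟨d, hd⟩ := QuotientGroup.mk_surjective (shadow M γ)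
  have h1 : shadow (Mof ci) γ = QuotientGroup.mk d := shadow_le hle γ d hd.symm
  have h2 : shadow (Mof ci) c = QuotientGroup.mk d := shadow_le hle c d (hc.trans hd.symm)
  exact hcU (h2.trans h1.symm)

/-- finite-set form of the endgame [cite: RibesZalesskii2010, §3.2] -/
theorem mem_of_forall_exists_shadow_eq_of_finite {C : Set (profiniteCompletion D)} (hC : C.Finite)
    {γ : profiniteCompletion D} (h : ∀ M : FiniteIndexNormalSubgroup D, ∃ c ∈ C, shadow M c = shadow M γ) :
    γ ∈ C :=
  mem_of_forall_exists_shadow_eq hC.isClosed h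

section Map

variable {E : Type u} [Group E]


/-- `mapHat φ` is continuous. [cite: RibesZalesskii2010, §3.2] -/
theorem continuous_mapHat (φ : D →* E) : Continuous (mapHat φ) :=
  (ProfiniteGrp.profiniteCompletion.map (GrpCat.ofHom φ)).hom.continuous_toFun

/-- `mapHat φ (η d) = η (φ d)`. [cite: RibesZalesskii2010, §3.2] -/
theorem mapHat_toCompletion (φ : D →* E) (d : D) : mapHat φ (toCompletion D d) = toCompletion E (φ d) :=
  Literature.IUT.HodgeTheaters.ProfiniteCompletion.profiniteCompletionMap_toCompletion φ d

/-- functoriality on elements: `(ψ ∘ φ)^ x = ψ̂ (φ̂ x)` [cite: RibesZalesskii2010, §3.2] -/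
theorem mapHat_comp_apply {E' : Type u} [Group E'] (φ : D →* E) (ψ : E →* E') (x : profiniteCompletion D) :
    mapHat (ψ.comp φ) x = mapHat ψ (mapHat φ x) := by
  have h := Literature.IUT.HodgeTheaters.ProfiniteCompletion.eq_of_forall_toCompletion
    (ψ₁ := fun v => mapHat (ψ.comp φ) v) (ψ₂ := fun v => mapHat ψ (mapHat φ v))
    (continuous_mapHat _) ((continuous_mapHat ψ).comp (continuous_mapHat φ))
    (fun g => by simp only [mapHat_toCompletion, MonoidHom.comp_apply])
  exact congrFun h x

/-- **shadows of a completed homomorphism**: the `M'`-shadow of `φ̂ x` is the image of the `φ⁻¹M'`-shadow of `x` [cite: RibesZalesskii2010, §3.2] -/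
theorem shadow_mapHat (φ : D →* E) (M' : FiniteIndexNormalSubgroup E) (x : profiniteCompletion D) :
    shadow M' (mapHat φ x) =
      QuotientGroup.map (M'.comap φ).toSubgroup M'.toSubgroup φ (fun _ h => h) (shadow (M'.comap φ) x) := by
  -- the coincidence set is closed and contains the dense `η(D)`
  haveI : Finite (D ⧸ (M'.comap φ).toSubgroup) := Subgroup.finite_quotient_of_finiteIndex
  have hcl : IsClosed {y : profiniteCompletion D | shadow M' (mapHat φ y) =
      QuotientGroup.map (M'.comap φ).toSubgroup M'.toSubgroup φ (fun _ h => h) (shadow (M'.comap φ) y)} := by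
    refine isClosed_setOf_shadow_eq_of_fibres (continuous_mapHat φ) M' _ (fun a => ?_)
    have hset : {y : profiniteCompletion D |
        QuotientGroup.map (M'.comap φ).toSubgroup M'.toSubgroup φ (fun _ h => h) (shadow (M'.comap φ) y) = a} =
        ⋃ b ∈ {b : D ⧸ (M'.comap φ).toSubgroup |
          QuotientGroup.map (M'.comap φ).toSubgroup M'.toSubgroup φ (fun _ h => h) b = a},
          {y | shadow (M'.comap φ) y = b} := by
      ext y
      simp only [Set.mem_setOf_eq, Set.mem_iUnion, exists_prop]
      exact ⟨fun hy => ⟨_, hy, rfl⟩, fun ⟨b, hb, hyb⟩ => hyb ▸ hb⟩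
    rw [hset]
    exact Set.Finite.isClosed_biUnion (Set.toFinite _) fun b _ => isClosed_shadow_fibre _ b
  have hsub : Set.range (toCompletion D) ⊆ {y : profiniteCompletion D | shadow M' (mapHat φ y) =
      QuotientGroup.map (M'.comap φ).toSubgroup M'.toSubgroup φ (fun _ h => h) (shadow (M'.comap φ) y)} := by
    rintro _ ⟨d, rfl⟩
    simp only [Set.mem_setOf_eq, mapHat_toCompletion, shadow_toCompletion, QuotientGroup.map_mk]
  have hdense : DenseRange (toCompletion D) := ProfiniteGrp.ProfiniteCompletion.denseRange (GrpCat.of D)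
  have huniv := Set.eq_univ_of_univ_subset (hdense.closure_range ▸ hcl.closure_subset_iff.mpr hsub)
  have hx : x ∈ (Set.univ : Set (profiniteCompletion D)) := trivial
  rw [← huniv] at hx
  exact hx

end Map


end Shadow


/-! ### More generic completion lemmas (trivial/identity/iso maps, finite groups, finite-index inclusions, exactness) -/

section Generic2

variable {D E : Type u} [Group D] [Group E]

/-- the completion of the trivial homomorphism is trivial. [cite: RibesZalesskii2010, §3.2] -/
theorem mapHat_one_apply {D E : Type u} [Group D] [Group E] (w : profiniteCompletion D) :
    mapHat (1 : D →* E) w = 1 := by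
  have h := Literature.IUT.HodgeTheaters.ProfiniteCompletion.eq_of_forall_toCompletion
    (ψ₁ := fun v => mapHat (1 : D →* E) v) (ψ₂ := fun _ => (1 : profiniteCompletion E))
    (continuous_mapHat _) continuous_const
    (fun v => by simp only [mapHat_toCompletion, MonoidHom.one_apply, map_one])
  exact congrFun h w

/-- the completion of an isomorphism is injective. [cite: RibesZalesskii2010, §3.2] -/
theorem mapHat_injective_of_mulEquiv {D E : Type u} [Group D] [Group E] (e : D ≃* E) :
    Function.Injective (mapHat (e : D →* E)) := by
  have hli : Function.LeftInverse (mapHat (e.symm : E →* D)) (mapHat (e : D →* E)) := by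
    intro w
    rw [← mapHat_comp_apply]
    have h := Literature.IUT.HodgeTheaters.ProfiniteCompletion.eq_of_forall_toCompletion
      (ψ₁ := fun v => mapHat ((e.symm : E →* D).comp (e : D →* E)) v) (ψ₂ := fun v => v)
      (continuous_mapHat _) continuous_id
      (fun v => by
        rw [mapHat_toCompletion, MonoidHom.comp_apply]
        simp)
    exact congrFun h w
  exact hli.injective

/-- shadows are detected through a completed homomorphism whose level pulls back to `M`. [cite: RibesZalesskii2010, §3.2] -/
theorem shadow_eq_of_mapHat_eq {D E : Type u} [Group D] [Group E] (φ : D →* E) (M' : FiniteIndexNormalSubgroup E)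
    {M : FiniteIndexNormalSubgroup D} (hM : (M'.comap φ).toSubgroup = M.toSubgroup)
    {y₁ y₂ : profiniteCompletion D} (h : mapHat φ y₁ = mapHat φ y₂) : shadow M y₁ = shadow M y₂ := by
  have hMM : M'.comap φ = M := FiniteIndexNormalSubgroup.toSubgroup_injective hM
  subst hMM
  have h' := congrArg (shadow M') h
  rw [shadow_mapHat, shadow_mapHat] at h'
  -- the induced map `D/φ⁻¹M' → E/M'` is injective
  obtain ⟨a, ha⟩ := QuotientGroup.mk_surjective (shadow (M'.comap φ) y₁)
  obtain ⟨b, hb⟩ := QuotientGroup.mk_surjective (shadow (M'.comap φ) y₂)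
  rw [← ha, ← hb] at h' ⊢
  rw [QuotientGroup.map_mk, QuotientGroup.map_mk, QuotientGroup.eq] at h'
  rw [QuotientGroup.eq]
  show a⁻¹ * b ∈ M'.toSubgroup.comap φ
  rw [Subgroup.mem_comap, map_mul, map_inv]
  exact h'


variable {D E : Type u} [Group D] [Group E]

/-- the completion of the identity is the identity. [cite: RibesZalesskii2010, §3.2] -/
theorem mapHat_id_apply (w : profiniteCompletion D) : mapHat (MonoidHom.id D) w = w := by
  have h := Literature.IUT.HodgeTheaters.ProfiniteCompletion.eq_of_forall_toCompletion
    (ψ₁ := fun v => mapHat (MonoidHom.id D) v) (ψ₂ := fun v => v)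
    (continuous_mapHat _) continuous_id
    (fun v => by simp only [mapHat_toCompletion, MonoidHom.id_apply])
  exact congrFun h w

/-- for a FINITE group `P`, `η_P` is surjective onto `P̂`. [cite: RibesZalesskii2010, §3.2] -/
theorem toCompletion_surjective_of_finite [Finite D] : Function.Surjective (toCompletion D) := by
  intro x
  let B0 : FiniteIndexNormalSubgroup D := FiniteIndexNormalSubgroup.ofSubgroup ⊥
  obtain ⟨d, hd⟩ := QuotientGroup.mk_surjective (shadow B0 x)
  refine ⟨d, eq_of_forall_shadow_eq fun M => ?_⟩
  have hle : B0 ≤ M := fun y hy => by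
    have : y ∈ (⊥ : Subgroup D) := hy
    rw [Subgroup.mem_bot] at this
    rw [this]; exact one_mem _
  rw [shadow_toCompletion]
  exact (shadow_le hle x d hd.symm).symm

/-- **injectivity** of `mapHat ι` for an injective `ι : D →* E` whose range has finite index (LANDED finite-index
comparison + `MonoidHom.ofInjective`). [cite: RibesZalesskii2010, §3.2] -/
theorem mapHat_injective_of_finiteIndex (ι : D →* E) (hι : Function.Injective ι) [ι.range.FiniteIndex] :
    Function.Injective (mapHat ι) := by
  let e : D ≃* ι.range := MonoidHom.ofInjective hι
  have hfac : ι = ι.range.subtype.comp (e : D →* _) := MonoidHom.ext fun _ => rfl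
  rw [hfac]
  intro w₁ w₂ h
  rw [mapHat_comp_apply, mapHat_comp_apply] at h
  have h1 := (Literature.IUT.HodgeTheaters.ProfiniteCompletion.profiniteCompletionMap_subtype_injective_and_range
    ι.range).1 h
  exact mapHat_injective_of_mulEquiv e h1

/-- **range** of `mapHat ι` for such `ι`: the closure of `η(range ι)`. [cite: RibesZalesskii2010, §3.2] -/
theorem range_mapHat_of_finiteIndex (ι : D →* E) (hι : Function.Injective ι) [ι.range.FiniteIndex] :
    Set.range (mapHat ι) = closure (toCompletion E '' (ι.range : Set E)) := by
  let e : D ≃* ι.range := MonoidHom.ofInjective hι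
  have hfac : ι = ι.range.subtype.comp (e : D →* _) := MonoidHom.ext fun _ => rfl
  have hsurj : Function.Surjective (mapHat (e : D →* ι.range)) := by
    intro y
    refine ⟨mapHat (e.symm : ι.range →* D) y, ?_⟩
    rw [← mapHat_comp_apply]
    have : (e : D →* ι.range).comp (e.symm : ι.range →* D) = MonoidHom.id _ := by ext v; simp
    rw [this, mapHat_id_apply]
  rw [← (Literature.IUT.HodgeTheaters.ProfiniteCompletion.profiniteCompletionMap_subtype_injective_and_range
    ι.range).2]
  conv_lhs => rw [hfac]
  ext y
  constructor
  · rintro ⟨w, rfl⟩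
    exact ⟨mapHat (e : D →* ι.range) w, (mapHat_comp_apply _ _ w).symm⟩
  · rintro ⟨z, rfl⟩
    obtain ⟨w, rfl⟩ := hsurj z
    exact ⟨w, mapHat_comp_apply _ _ w⟩

/-- **exactness at the middle** of `ker φ → E → P` after completion, for `P` FINITE: an element of `Ê` killed by
`φ̂` lies in the closure of `η(ker φ)` (shadows: its `M`-shadow lies in the image of `ker φ`, via the level `φ(M)`). [cite: RibesZalesskii2010, §3.2] -/
theorem mem_closure_ker_of_mapHat_eq_one {P : Type u} [Group P] [Finite P] (φ : E →* P)
    {z : profiniteCompletion E} (hz : mapHat φ z = 1) :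
    z ∈ closure (toCompletion E '' (φ.ker : Set E)) := by
  apply mem_of_forall_exists_shadow_eq isClosed_closure
  intro M
  -- the level `M' := φ(M)` of `P` (normal of finite index since `P` is finite ... we use `φ(M)` normal in `φ(E)`?)
  -- simpler: use the level `⊥` of `P`: `comap φ ⊥ = ker φ`.
  let B0 : FiniteIndexNormalSubgroup P := FiniteIndexNormalSubgroup.ofSubgroup ⊥
  have h1 : shadow B0 (mapHat φ z) = 1 := by rw [hz]; rfl
  rw [shadow_mapHat] at h1
  -- h1 : map (shadow (comap φ ⊥) z) = 1, i.e. a representative of the (ker φ)-shadow of z lies in ker φ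
  obtain ⟨e, he⟩ := QuotientGroup.mk_surjective (shadow (B0.comap φ) z)
  rw [← he, QuotientGroup.map_mk, QuotientGroup.eq_one_iff] at h1
  have heK : e ∈ φ.ker := by
    have : φ e ∈ (⊥ : Subgroup P) := h1
    rwa [Subgroup.mem_bot] at this
  -- the shadow of `z` at `M ⊓ comap φ ⊥` refines both
  let M₁ : FiniteIndexNormalSubgroup E := M ⊓ B0.comap φ
  obtain ⟨e₁, he₁⟩ := QuotientGroup.mk_surjective (shadow M₁ z)
  have hM : shadow M z = QuotientGroup.mk e₁ := shadow_le inf_le_left z e₁ he₁.symm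
  have hK : shadow (B0.comap φ) z = QuotientGroup.mk e₁ := shadow_le inf_le_right z e₁ he₁.symm
  -- e₁ ≡ e mod ker φ, so e₁ ∈ ker φ
  have he₁K : e₁ ∈ φ.ker := by
    rw [← he] at hK
    have := QuotientGroup.eq.mp hK
    -- this : e⁻¹ * e₁ ∈ comap φ ⊥ = ker
    have h2 : e⁻¹ * e₁ ∈ φ.ker := by
      have h3 : e⁻¹ * e₁ ∈ (B0.comap φ).toSubgroup := this
      rw [FiniteIndexNormalSubgroup.toSubgroup_comap] at h3
      have : φ (e⁻¹ * e₁) ∈ (⊥ : Subgroup P) := h3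
      rwa [Subgroup.mem_bot] at this
    have := φ.ker.mul_mem heK h2
    rwa [mul_inv_cancel_left] at this
  exact ⟨toCompletion E e₁, subset_closure ⟨e₁, he₁K, rfl⟩, by rw [shadow_toCompletion, hM]⟩


end Generic2

end Literature.AnabelianGeometry.EtaleTheta.SettingModel.TreeFree

end
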